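import Literature.Algebra.Homology.OrderedCechPairSystemShuffle
import Literature.Algebra.Homology.OrderedCechSystemCup
import HarnessLib

/-!
# The cup product of two pull-backs along the projections of a product-type index set READS on the front∕back words
# (Eilenberg–Mac Lane 1953 §5; Godement II §6.6; The Stacks Project, Tags 01FG, 0BEC)

Layer `Literature/Algebra/Homology` (pure algebra; THEOREMS only: no definition, no instance, no notation, no named fact, no
`sorry`).  Cell `hodgecm-mathlib` FLOOR 0, P1 sub-line F-11, packet (iv)∕J3 (Künneth on the product cover), bridge letter (B-ii)
«cross = `p₁♯ ∪ p₂♯`», CUP-SIDE read-out (B-p06 (g15) CUT 00:55:58Z «OFFER 2 → F0P1a-p02 (g3)»); the cross-side read-out is ★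
`OrderedCechPairSystemCrossTensor`.  HC_CM is proved only modulo the 7 printed citations until rung 0 closes — nothing here bears on
a summit statement.

SETTING.  `ι`, `κ` linearly ordered; systems `M` on `ι`, `N` on `κ`; target systems `M'`, `N'`, `P'` on the lexicographic product
`ι ×ₗ κ` with a pairing `β_T : M' T × N' T → P' T` (★ `OrderedCech.cup β a b n`: `(f' ∪ g')_T = Σ_{v ∈ T} β_T (f'|front_{≤v}) (g'|back_{≥v})`,
only the vertex `v = v_a` with `#T_{≤v} = a + 1` contributing); refinement data `φ₁ : imageFunctor (fun c => (ofLex c).1) ⋙ M ⟶ M'`,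
`φ₂ : imageFunctor (fun c => (ofLex c).2) ⋙ N ⟶ N'` along the two projections (e.g. ★ DEF #14 `pullbackSystemHom p₁ …`,
`pullbackSystemHom p₂ …` for a product cover `W₀ (i, j) ⊆ p₁⁻¹ U_i ∩ p₂⁻¹ V_j`); ★ core-1 `refineCochain` (component at a chain `T'`
= `φ (g.altEvalAt (θ ∘ sorted enumeration of T') (θ T'))`); ★ D16 `frontWord T h : Fin (a+1) → ι`, `backWord T h : Fin (b+1) → κ`
(the `π₁`-word of the first `a + 1` vertices and the `π₂`-word of the last `b + 1` vertices of a chain `T` with `#T = a + b + 1`).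

* §1 (generic `Finset` combinatorics of a sorted enumeration, any linear order `X`): for `s.card = c` and a position `j < c`,
  the LOWER CUT `s.filter (· ≤ s.orderEmbOfFin h j)` is the image of the first `j + 1` positions (`filter_le_orderEmbOfFin_eq_image`,
  `card_filter_le_orderEmbOfFin`, `orderEmbOfFin_filter_le_apply`) and the UPPER CUT `s.filter (s.orderEmbOfFin h j ≤ ·)` is the image of
  the last `c - j` positions (`filter_ge_orderEmbOfFin_eq_image`, `card_filter_ge_orderEmbOfFin`, `orderEmbOfFin_filter_ge_apply`);
  `SysCochain.altEvalAt_comp_cast` (re-indexing a word along `Fin.cast` does not change the signed evaluation).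
* §2 the WORD IDENTITIES: the `π₁`-word of the sorted enumeration of the front face `T_{≤ v_a}` is `frontWord T` and the `π₂`-word of
  the back face `T_{≥ v_a}` is `backWord T` (`fst_comp_orderEmbOfFin_frontFace`, `snd_comp_orderEmbOfFin_backFace`), and the faces
  are an `a`- resp. `b`-simplex (`card_frontFace`, `card_backFace`).
* §3 **`cup_refineCochain_fst_snd_apply`** — THE READ-OUT: for `0 ≤ a`, `0 ≤ b`, `a + b = n` and an `n`-chain `T` of `ι ×ₗ κ`,
  `(φ₁^♯ f ∪ φ₂^♯ g)_T = β_T ((φ₁ (f.altEvalAt (frontWord T) (π₁ T_{≤v_a})))|_T) ((φ₂ (g.altEvalAt (backWord T) (π₂ T_{≥v_a})))|_T)`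
  ([EilenbergMacLane1953] §5, [Godement1958] II §6.6: the Alexander–Whitney formula `(p₁^*f ∪ p₂^*g)(w₀…w_n) = f(π₁w₀…π₁w_a)·g(π₂w_a…π₂w_n)`).
  No naturality of `β` is needed (pointwise identity).

## References
* S. Eilenberg, S. Mac Lane, *On the groups `H(Π,n)`, I*, Ann. of Math. 58 (1953), §5. [EilenbergMacLane1953]
* R. Godement, *Topologie algébrique et théorie des faisceaux* (1958), II §6.6 (cup product on Čech cochains). [Godement1958]
* The Stacks Project, Tag 01FG (alternating Čech cochains), Tag 0BEC (Künneth). [StacksProject]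
-/

universe v u

open CategoryTheory

set_option backward.isDefEq.respectTransparency false -- `ModuleCat`-valued functors (as in ★ `OrderedCechSystem`)

noncomputable section

namespace Literature.Algebra.Homology

namespace OrderedCech

/-! ## §1 Lower and upper cuts at a vertex of given position -/

section Cuts

variable {X : Type} [LinearOrder X] (s : Finset X) {c : ℕ} (h : s.card = c)

/-- The lower cut of `s` at its `j`-th vertex is the image of the first `j + 1` positions of the sorted enumeration.
[cite: StacksProject, Tag 01FG] -/
theorem filter_le_orderEmbOfFin_eq_image (j : Fin c) :
    s.filter (· ≤ s.orderEmbOfFin h j) =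
      Finset.univ.image (fun k : Fin (j + 1) => s.orderEmbOfFin h ⟨k, by omega⟩) := by
  ext x
  simp only [Finset.mem_filter, Finset.mem_image, Finset.mem_univ, true_and]
  constructor
  · rintro ⟨hx, hle⟩
    have hx' : x ∈ Set.range (s.orderEmbOfFin h) := by rw [Finset.range_orderEmbOfFin]; exact hx
    obtain ⟨i, rfl⟩ := hx'
    have hi : i ≤ j := (s.orderEmbOfFin h).le_iff_le.1 hle
    exact ⟨⟨i, Nat.lt_succ_of_le hi⟩, congrArg _ (Fin.ext rfl)⟩
  · rintro ⟨k, rfl⟩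
    exact ⟨Finset.orderEmbOfFin_mem _ _ _, (s.orderEmbOfFin h).monotone (Fin.mk_le_mk.2 (Nat.le_of_lt_succ k.2))⟩

/-- The lower cut at the `j`-th vertex has `j + 1` elements. [cite: StacksProject, Tag 01FG] -/
theorem card_filter_le_orderEmbOfFin (j : Fin c) : (s.filter (· ≤ s.orderEmbOfFin h j)).card = j + 1 := by
  rw [filter_le_orderEmbOfFin_eq_image s h j, Finset.card_image_of_injective _ fun k l hkl => ?_, Finset.card_univ,
    Fintype.card_fin]
  exact Fin.ext (by simpa using congrArg Fin.val ((s.orderEmbOfFin h).injective hkl))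

/-- The sorted enumeration of the lower cut at the `j`-th vertex is the restriction of the sorted enumeration of `s` to the
first `j + 1` positions. [cite: StacksProject, Tag 01FG] -/
theorem orderEmbOfFin_filter_le_apply (j : Fin c) {m : ℕ} (h' : (s.filter (· ≤ s.orderEmbOfFin h j)).card = m)
    (k : Fin m) : (s.filter (· ≤ s.orderEmbOfFin h j)).orderEmbOfFin h' k = s.orderEmbOfFin h ⟨k, by
      have := card_filter_le_orderEmbOfFin s h j; omega⟩ := by
  have hm : m = j + 1 := by rw [← h', card_filter_le_orderEmbOfFin]
  subst hm
  have hu := Finset.orderEmbOfFin_unique h' (f := fun k : Fin (j + 1) => s.orderEmbOfFin h ⟨k, by omega⟩)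
    (fun k => Finset.mem_filter.2
      ⟨Finset.orderEmbOfFin_mem _ _ _, (s.orderEmbOfFin h).monotone (Fin.mk_le_mk.2 (Nat.le_of_lt_succ k.2))⟩)
    (fun k l hkl => (s.orderEmbOfFin h).strictMono (Fin.mk_lt_mk.2 hkl))
  exact (congrFun hu k).symm

/-- The upper cut of `s` at its `j`-th vertex is the image of the last `c - j` positions of the sorted enumeration.
[cite: StacksProject, Tag 01FG] -/
theorem filter_ge_orderEmbOfFin_eq_image (j : Fin c) :
    s.filter (s.orderEmbOfFin h j ≤ ·) =
      Finset.univ.image (fun k : Fin (c - j) => s.orderEmbOfFin h ⟨j + k, by omega⟩) := by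
  ext x
  simp only [Finset.mem_filter, Finset.mem_image, Finset.mem_univ, true_and]
  constructor
  · rintro ⟨hx, hle⟩
    have hx' : x ∈ Set.range (s.orderEmbOfFin h) := by rw [Finset.range_orderEmbOfFin]; exact hx
    obtain ⟨i, rfl⟩ := hx'
    have hi : j ≤ i := (s.orderEmbOfFin h).le_iff_le.1 hle
    exact ⟨⟨i - j, by omega⟩, congrArg _ (Fin.ext (by simp only; omega))⟩
  · rintro ⟨k, rfl⟩
    exact ⟨Finset.orderEmbOfFin_mem _ _ _, (s.orderEmbOfFin h).monotone (Fin.mk_le_mk.2 (Nat.le_add_right _ _))⟩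

/-- The upper cut at the `j`-th vertex has `c - j` elements. [cite: StacksProject, Tag 01FG] -/
theorem card_filter_ge_orderEmbOfFin (j : Fin c) : (s.filter (s.orderEmbOfFin h j ≤ ·)).card = c - j := by
  rw [filter_ge_orderEmbOfFin_eq_image s h j, Finset.card_image_of_injective _ fun k l hkl => ?_, Finset.card_univ,
    Fintype.card_fin]
  have := congrArg Fin.val ((s.orderEmbOfFin h).injective hkl)
  exact Fin.ext (by simp only at this; omega)

/-- The sorted enumeration of the upper cut at the `j`-th vertex is the sorted enumeration of `s` shifted by `j`.
[cite: StacksProject, Tag 01FG] -/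
theorem orderEmbOfFin_filter_ge_apply (j : Fin c) {m : ℕ} (h' : (s.filter (s.orderEmbOfFin h j ≤ ·)).card = m)
    (k : Fin m) : (s.filter (s.orderEmbOfFin h j ≤ ·)).orderEmbOfFin h' k = s.orderEmbOfFin h ⟨j + k, by
      have := card_filter_ge_orderEmbOfFin s h j; omega⟩ := by
  have hm : m = c - j := by rw [← h', card_filter_ge_orderEmbOfFin]
  subst hm
  have hu := Finset.orderEmbOfFin_unique h' (f := fun k : Fin (c - j) => s.orderEmbOfFin h ⟨j + k, by omega⟩)
    (fun k => Finset.mem_filter.2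
      ⟨Finset.orderEmbOfFin_mem _ _ _, (s.orderEmbOfFin h).monotone (Fin.mk_le_mk.2 (Nat.le_add_right _ _))⟩)
    (fun k l hkl => (s.orderEmbOfFin h).strictMono (Fin.mk_lt_mk.2 (by simpa using hkl)))
  exact (congrFun hu k).symm

end Cuts

section AltEval

variable {X : Type} [LinearOrder X] {A : Type u} [CommRing A] {M : Finset X ⥤ ModuleCat.{v} A} {n : ℤ}

/-- Re-indexing a word along `Fin.cast` does not change its signed evaluation. [cite: StacksProject, Tag 01FG] -/
theorem SysCochain.altEvalAt_comp_cast (g : SysCochain M n) {m m' : ℕ} (e : m = m') (α : Fin m' → X) (t : Finset X) :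
    g.altEvalAt (α ∘ Fin.cast e) t = g.altEvalAt α t := by
  subst e
  rw [Fin.cast_refl, Function.comp_id]

end AltEval

/-! ## §2 Front and back faces of a chain of `ι ×ₗ κ` and their words -/

section Words

variable {ι κ : Type} [LinearOrder ι] [LinearOrder κ]

/-- The FRONT face `T_{≤ v_a}` of an `n`-chain `T` of `ι ×ₗ κ` (`n = a + b`, `v_a` its `a`-th vertex) has `a + 1` vertices.
[cite: EilenbergMacLane1953, §5] -/
theorem card_frontFace {a b n : ℤ} (h : 0 ≤ a ∧ 0 ≤ b ∧ a + b = n) (T : Simplex (ι ×ₗ κ) n) :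
    (T.1.filter (· ≤ T.1.orderEmbOfFin (crossCard h T) ⟨a.toNat, by omega⟩)).card = a.toNat + 1 :=
  card_filter_le_orderEmbOfFin T.1 (crossCard h T) ⟨a.toNat, by omega⟩

/-- The BACK face `T_{≥ v_a}` of an `n`-chain `T` of `ι ×ₗ κ` (`n = a + b`) has `b + 1` vertices. [cite: EilenbergMacLane1953, §5] -/
theorem card_backFace {a b n : ℤ} (h : 0 ≤ a ∧ 0 ≤ b ∧ a + b = n) (T : Simplex (ι ×ₗ κ) n) :
    (T.1.filter (T.1.orderEmbOfFin (crossCard h T) ⟨a.toNat, by omega⟩ ≤ ·)).card = b.toNat + 1 := by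
  rw [card_filter_ge_orderEmbOfFin T.1 (crossCard h T) ⟨a.toNat, by omega⟩]
  simp only
  omega

/-- **Word identity, front**: the `π₁`-word of the sorted enumeration of the front face `T_{≤ v_a}` is `frontWord T` (re-indexed
along the cardinality `#T_{≤ v_a} = a + 1`). [cite: EilenbergMacLane1953, §5] -/
theorem fst_comp_orderEmbOfFin_frontFace {a b n : ℤ} (h : 0 ≤ a ∧ 0 ≤ b ∧ a + b = n) (T : Simplex (ι ×ₗ κ) n) {m : ℕ}
    (h' : (T.1.filter (· ≤ T.1.orderEmbOfFin (crossCard h T) ⟨a.toNat, by omega⟩)).card = m) (e : m = a.toNat + 1) :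
    (fun c : ι ×ₗ κ => (ofLex c).1) ∘
        ⇑((T.1.filter (· ≤ T.1.orderEmbOfFin (crossCard h T) ⟨a.toNat, by omega⟩)).orderEmbOfFin h') =
      frontWord T.1 (crossCard h T) ∘ Fin.cast e := by
  funext k
  change (ofLex ((T.1.filter _).orderEmbOfFin h' k)).1 = (ofLex (T.1.orderEmbOfFin (crossCard h T) ⟨(Fin.cast e k : ℕ), _⟩)).1
  rw [orderEmbOfFin_filter_le_apply T.1 (crossCard h T) ⟨a.toNat, by omega⟩ h' k]
  rfl

/-- **Word identity, back**: the `π₂`-word of the sorted enumeration of the back face `T_{≥ v_a}` is `backWord T` (re-indexed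
along `#T_{≥ v_a} = b + 1`). [cite: EilenbergMacLane1953, §5] -/
theorem snd_comp_orderEmbOfFin_backFace {a b n : ℤ} (h : 0 ≤ a ∧ 0 ≤ b ∧ a + b = n) (T : Simplex (ι ×ₗ κ) n) {m : ℕ}
    (h' : (T.1.filter (T.1.orderEmbOfFin (crossCard h T) ⟨a.toNat, by omega⟩ ≤ ·)).card = m) (e : m = b.toNat + 1) :
    (fun c : ι ×ₗ κ => (ofLex c).2) ∘
        ⇑((T.1.filter (T.1.orderEmbOfFin (crossCard h T) ⟨a.toNat, by omega⟩ ≤ ·)).orderEmbOfFin h') =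
      backWord T.1 (crossCard h T) ∘ Fin.cast e := by
  funext k
  change (ofLex ((T.1.filter _).orderEmbOfFin h' k)).2 =
    (ofLex (T.1.orderEmbOfFin (crossCard h T) ⟨a.toNat + (Fin.cast e k : ℕ), _⟩)).2
  rw [orderEmbOfFin_filter_ge_apply T.1 (crossCard h T) ⟨a.toNat, by omega⟩ h' k]
  rfl

end Words

/-! ## §3 The read-out of `φ₁^♯ f ∪ φ₂^♯ g` -/

section Cup

variable {ι κ : Type} [LinearOrder ι] [LinearOrder κ] {A : Type u} [CommRing A]
  {M : Finset ι ⥤ ModuleCat.{v} A} {N : Finset κ ⥤ ModuleCat.{v} A}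
  {M' N' P' : Finset (ι ×ₗ κ) ⥤ ModuleCat.{v} A}
  (β : ∀ T : Finset (ι ×ₗ κ), M'.obj T →ₗ[A] N'.obj T →ₗ[A] P'.obj T)
  (φ₁ : imageFunctor (fun c : ι ×ₗ κ => (ofLex c).1) ⋙ M ⟶ M')
  (φ₂ : imageFunctor (fun c : ι ×ₗ κ => (ofLex c).2) ⋙ N ⟶ N')

/-- Only the vertex in position `a` has a lower cut with `a + 1` elements: at any other vertex the front factor of the cup
summand of an `a`-cochain vanishes. [cite: Godement1958, II §6.6] -/
theorem ext0At_filter_le_eq_zero_of_ne {a b n : ℤ} (h : 0 ≤ a ∧ 0 ≤ b ∧ a + b = n) (f' : SysCochain M' a)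
    (T : Simplex (ι ×ₗ κ) n) {w : ι ×ₗ κ} (hw : w ∈ T.1)
    (hne : w ≠ T.1.orderEmbOfFin (crossCard h T) ⟨a.toNat, by omega⟩) :
    f'.ext0At (T.1.filter (· ≤ w)) T.1 = 0 := by
  have hw' : w ∈ Set.range (T.1.orderEmbOfFin (crossCard h T)) := by rw [Finset.range_orderEmbOfFin]; exact hw
  obtain ⟨j, rfl⟩ := hw'
  apply ext0At_lowerCut_eq_zero
  rw [card_filter_le_orderEmbOfFin T.1 (crossCard h T) j]
  intro hj
  apply hne
  congr 1
  exact Fin.ext (by simp only; omega)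

/-- **THE CUP-SIDE READ-OUT (Alexander–Whitney formula for `φ₁^♯ f ∪ φ₂^♯ g`).**  For `0 ≤ a`, `0 ≤ b`, `a + b = n`, cochains
`f ∈ Čᵃ(M)`, `g ∈ Čᵇ(N)` and an `n`-chain `T = {w₀ < ⋯ < w_n}` of `ι ×ₗ κ` with `a`-th vertex `v_a = w_a`, front face
`T_{≤ v_a} = {w₀, …, w_a}` and back face `T_{≥ v_a} = {w_a, …, w_n}`:
`(φ₁^♯ f ∪_β φ₂^♯ g)_T = β_T ((φ₁ (f.altEvalAt (frontWord T) (π₁ T_{≤ v_a})))|_T) ((φ₂ (g.altEvalAt (backWord T) (π₂ T_{≥ v_a})))|_T)`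
— the cup sum has the single surviving vertex `v_a`, the pull-backs ★ `refineCochain` evaluate on the sorted enumerations of the
faces, and these read the words `frontWord`∕`backWord` of ★ D16 (§2).  No naturality of `β` is used.
[cite: EilenbergMacLane1953, §5] [cite: Godement1958, II §6.6] -/
theorem cup_refineCochain_fst_snd_apply {a b n : ℤ} (h : 0 ≤ a ∧ 0 ≤ b ∧ a + b = n) (f : SysCochain M a)
    (g : SysCochain N b) (T : Simplex (ι ×ₗ κ) n) :
    cup β a b n (refineCochain (fun c : ι ×ₗ κ => (ofLex c).1) φ₁ a f)
        (refineCochain (fun c : ι ×ₗ κ => (ofLex c).2) φ₂ b g) T =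
      β T.1
        ((M'.map (homOfLE (Finset.filter_subset _ T.1))).hom
          ((φ₁.app (T.1.filter (· ≤ T.1.orderEmbOfFin (crossCard h T) ⟨a.toNat, by omega⟩))).hom
            (f.altEvalAt (frontWord T.1 (crossCard h T))
              ((T.1.filter (· ≤ T.1.orderEmbOfFin (crossCard h T) ⟨a.toNat, by omega⟩)).image
                fun c : ι ×ₗ κ => (ofLex c).1))))
        ((N'.map (homOfLE (Finset.filter_subset _ T.1))).hom
          ((φ₂.app (T.1.filter (T.1.orderEmbOfFin (crossCard h T) ⟨a.toNat, by omega⟩ ≤ ·))).hom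
            (g.altEvalAt (backWord T.1 (crossCard h T))
              ((T.1.filter (T.1.orderEmbOfFin (crossCard h T) ⟨a.toNat, by omega⟩ ≤ ·)).image
                fun c : ι ×ₗ κ => (ofLex c).2)))) := by
  -- the `a`-th vertex and the two faces
  have hv : T.1.orderEmbOfFin (crossCard h T) ⟨a.toNat, by omega⟩ ∈ T.1 := Finset.orderEmbOfFin_mem _ _ _
  have hF := card_frontFace h T
  have hB := card_backFace h T
  rw [cup_apply, Finset.sum_eq_single (T.1.orderEmbOfFin (crossCard h T) ⟨a.toNat, by omega⟩)
    (fun w hw hne => by rw [ext0At_filter_le_eq_zero_of_ne h _ T hw hne, map_zero, LinearMap.zero_apply])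
    (fun hn => absurd hv hn)]
  -- the two faces are simplices of the right dimension: unfold `ext0At` on them
  have hFs : (T.1.filter (· ≤ T.1.orderEmbOfFin (crossCard h T) ⟨a.toNat, by omega⟩)).Nonempty ∧
      (((T.1.filter (· ≤ T.1.orderEmbOfFin (crossCard h T) ⟨a.toNat, by omega⟩)).card : ℤ) = a + 1) :=
    ⟨⟨_, self_mem_lowerCut hv⟩, by rw [hF]; push_cast; omega⟩
  have hBs : (T.1.filter (T.1.orderEmbOfFin (crossCard h T) ⟨a.toNat, by omega⟩ ≤ ·)).Nonempty ∧
      (((T.1.filter (T.1.orderEmbOfFin (crossCard h T) ⟨a.toNat, by omega⟩ ≤ ·)).card : ℤ) = b + 1) :=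
    ⟨⟨_, self_mem_upperCut hv⟩, by rw [hB]; push_cast; omega⟩
  rw [SysCochain.ext0At_val _ ⟨_, hFs⟩ T.1 (Finset.filter_subset _ T.1),
    SysCochain.ext0At_val _ ⟨_, hBs⟩ T.1 (Finset.filter_subset _ T.1), refineCochain_apply, refineCochain_apply]
  -- the words of the sorted enumerations of the faces are `frontWord` ∕ `backWord`
  change β T.1 ((M'.map _).hom ((φ₁.app _).hom (f.altEvalAt ((fun c : ι ×ₗ κ => (ofLex c).1) ∘ _) _)))
      ((N'.map _).hom ((φ₂.app _).hom (g.altEvalAt ((fun c : ι ×ₗ κ => (ofLex c).2) ∘ _) _))) = _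
  rw [fst_comp_orderEmbOfFin_frontFace h T rfl hF, snd_comp_orderEmbOfFin_backFace h T rfl hB,
    SysCochain.altEvalAt_comp_cast, SysCochain.altEvalAt_comp_cast]
  rfl

end Cup

end OrderedCech

end Literature.Algebra.Homology

end
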